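import Mathlib
import Summits.NavierStokesRegularity.NavierStokesRegularity.Theses.SubOnsagerCeiling
import HarnessLib

/-!
# Route SubOnsagerCeiling — objects posited by the crux skeleton «shell-barrier»
(definitions file for the crux `SubOnsagerCeiling.OrthantTailCeiling`, item
stmt-NavierStokesRegularity-25507; D-0016: definitions a crux line needs are reviewed, never
buried in a proof file)

The registered skeleton `Cruxes/OrthantTailCeiling/Lines/shell_barrier.lean` (planner ns-idea-1
g4, v3, sha 09b0ed5300f0; lead prover-ns-soc-p2) decomposes the crux by scale-ratio regime into
three stubs over the following PROPOSITIONS (statements only; nothing is asserted here):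

* `CeilingAt R ε₀ α` — the body of the route decl `OrthantTailCeiling` at ONE table and ONE
  scale ratio (`orthantTailCeiling_iff_ceilingAt`: the route decl is `∀ R ≥ 1, ∀ ε₀ ∈ (0,1],
  ∀ α, CeilingAt R ε₀ α`, definitionally);
* `ShellBarrierAt R ε₀ α` — the CZ/BMR-type two-level SHELL BARRIER: a `ν`-uniform weighted
  per-shell bound `(1+ε₀)^{2θk}·½X_{i,k}(t)² ≤ D·E₀`, `θ > 1/2`, along every honest viscous
  solution from one-shell data that is non-negative on shells `≥ 1` (Barbato–Morandin–Romito
  2011, Lemma 2.1 / proof of Thm. 1, first claim, is the `ε₀ = 1` dyadic instance: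
  `sup_{t} sup_n λₙ^{β-2+ε}Xₙ(t) ≤ δ⁻¹ sup_n λₙ^{β-2+ε}Xₙ(0)`, tree
  `Literature.Barriers.NavierStokesRegularity.Dyadic.IsBMRWeakSolution.scale_bound`);
* `IsScaledDyadic α` — the scaled one-mode dyadic (Katz–Pavlović) tables `c·dyadicTable`, `c > 0`;
* the three registered stub statements `Sig.stub_dyadicRatioTwo` (RUNG: `ε₀ = 1`, scaled dyadic
  tables), `Sig.stub_barrierLargeRatio` (`1/4 < ε₀ ≤ 1`, every table), `Sig.stub_barrierSmallRatio`
  (`0 < ε₀ ≤ 1/4`, every table).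

HONEST FRAMING: statements about Tao-type MODEL lattice ODEs (route SubOnsagerCeiling, rung
TL-M2Break); the two barrier stubs are OPEN research statements (they may be false as stated);
nothing here bears on Navier–Stokes regularity and no summit is proved.
-/

noncomputable section

-- the sub-problem namespace `NavierStokesRegularity.NavierStokesRegularity` is the tree's layout (D-0017)
set_option linter.dupNamespace false

namespace Summit.NavierStokesRegularity.NavierStokesRegularity.Theorems.SubOnsagerCeiling

open Summit.NavierStokesRegularity.NavierStokesRegularity.Theses.SubOnsagerCeiling

/-- The tail ceiling for ONE table `α` at ONE scale ratio `1+ε₀` with spread parameter `R`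
(verbatim body of the route decl `OrthantTailCeiling` after its three leading binders): for
`α ∈ E₂(R)` orthant there are `θ > 1/2`, `C ≥ 0` with
`Σ_{k=n..N} Σ_i ½X_{i,k}(t)² ≤ C·E₀·(1+ε₀)^{-2θn}` along every honest `ν`-viscous solution from a
one-shell datum that is non-negative on shells `≥ 1`. [this file; route SubOnsagerCeiling] -/
def CeilingAt (R ε₀ : ℝ) (α : Fin 4 → Fin 4 → Fin 4 → ℤ × ℤ × ℤ → ℝ) : Prop :=
  Literature.Analysis.FluidPDE.TaoCascade.InTableClass R α → (∀ (Y : Fin 4 → ℤ → ℝ → ℝ) (τ : ℝ), (∀ (j : Fin 4) (k : ℤ), 1 ≤ k → 0 ≤ Y j k τ) → ∀ δ : ℝ, 0 < δ → ∀ (i : Fin 4) (n : ℤ), 1 ≤ n → Y i n τ = 0 → 0 ≤ Literature.Analysis.FluidPDE.TaoCascade.quadTerm δ α Y i n τ) → ∃ θ : ℝ, 1 / 2 < θ ∧ ∃ C : ℝ, 0 ≤ C ∧ ∀ ν : ℝ, 0 < ν → ∀ (X₀ : Fin 4 → ℝ) (s : ℝ), 0 < s → ∀ X : Fin 4 → ℤ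 → ℝ → ℝ, (∀ (i : Fin 4) (k : ℤ), X i k 0 = if k = 0 then X₀ i else 0) → (∀ (i : Fin 4) (k : ℤ), k < 0 → ∀ t : ℝ, X i k t = 0) → (∃ M : ℝ, ∀ (t : ℝ) (i : Fin 4) (k : ℤ), (1 + (1 + ε₀) ^ ((10 : ℝ) * k)) * |X i k t| ≤ M) → (∀ (i : Fin 4) (k : ℤ), Continuous (X i k)) → (∀ (i : Fin 4) (k : ℤ), ∀ t ∈ Set.Icc (0 : ℝ) s, HasDerivWithinAt (X i k) (Literature.Analysis.FluidPDE.TaoCascade.quadTerm ε₀ α X i k t - ν * (1 + ε₀) ^ ((2 : ℝ) * k) * X i k t) (Set.Icc (0 : ℝ) s) t) → (∀ t ∈ Set.Icc (0 : ℝ) s, ∀ (i : Fin 4) (k : ℤ), 1 ≤ k → 0 ≤ X i k t) → ∀ n N : ℕ, n ≤ N → ∀ t ∈ Set.Icc (0 : ℝ) s, ∑ k ∈ Finset.Icc n N, ∑ i : Fin 4, (1 / 2 : ℝ) * X i (k : ℤ) t ^ 2 ≤ C * (∑ i : Fin 4, (1 / 2 : ℝ) * X₀ i ^ 2) * (1 +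 ε₀) ^ (-(2 * θ * (n : ℝ)))

/-- The route decl `OrthantTailCeiling` is, definitionally, `CeilingAt` at every spread `R ≥ 1`,
every scale ratio `ε₀ ∈ (0, 1]` and every table. [this file; route SubOnsagerCeiling] -/
theorem orthantTailCeiling_iff_ceilingAt :
    OrthantTailCeiling ↔ ∀ R : ℝ, 1 ≤ R → ∀ ε₀ : ℝ, 0 < ε₀ → ε₀ ≤ 1 →
      ∀ α : Fin 4 → Fin 4 → Fin 4 → ℤ × ℤ × ℤ → ℝ, CeilingAt R ε₀ α := Iff.rfl

/-- The two-level SHELL BARRIER for one table at one scale ratio: for `α ∈ E₂(R)` orthant there are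
`θ > 1/2` and `D ≥ 0` such that, uniformly in the viscosity `ν > 0`, every honest `ν`-viscous
solution on `[0, s]` from a one-shell datum `X₀` that is non-negative on shells `≥ 1` obeys the
weighted per-shell bound `(1+ε₀)^{2θk}·½X_{i,k}(t)² ≤ D·Σ_j ½(X₀ j)²` for all `t ∈ [0, s]`, all
components `i` and all shells `k ≥ 0` (shape of Barbato–Morandin–Romito 2011, proof of Thm. 1,
first claim: `sup_t sup_n λₙ^{β-2+ε}Xₙ(t) ≤ δ⁻¹ sup_n λₙ^{β-2+ε}Xₙ(0)`, and of Cheskidov–Zaya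
2016 Thm. 4.2). [this file; route SubOnsagerCeiling] -/
def ShellBarrierAt (R ε₀ : ℝ) (α : Fin 4 → Fin 4 → Fin 4 → ℤ × ℤ × ℤ → ℝ) : Prop :=
  Literature.Analysis.FluidPDE.TaoCascade.InTableClass R α → (∀ (Y : Fin 4 → ℤ → ℝ → ℝ) (τ : ℝ), (∀ (j : Fin 4) (k : ℤ), 1 ≤ k → 0 ≤ Y j k τ) → ∀ δ : ℝ, 0 < δ → ∀ (i : Fin 4) (n : ℤ), 1 ≤ n → Y i n τ = 0 → 0 ≤ Literature.Analysis.FluidPDE.TaoCascade.quadTerm δ α Y i n τ) → ∃ θ : ℝ, 1 / 2 < θ ∧ ∃ D : ℝ, 0 ≤ D ∧ ∀ ν : ℝ, 0 < ν → ∀ (X₀ : Fin 4 → ℝ) (s : ℝ), 0 < s → ∀ X : Fin 4 → ℤ → ℝ → ℝ, (∀ (i : Fin 4) (k : ℤ), X i k 0 = if k = 0 then X₀ i else 0) → (∀ (i : Fin 4) (k : ℤ), k < 0 → ∀ t : ℝ, X i k t = 0) → (∃ M : ℝ, ∀ (t : ℝ) (i : Fin 4) (k : ℤ), (1 + (1 +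 ε₀) ^ ((10 : ℝ) * k)) * |X i k t| ≤ M) → (∀ (i : Fin 4) (k : ℤ), Continuous (X i k)) → (∀ (i : Fin 4) (k : ℤ), ∀ t ∈ Set.Icc (0 : ℝ) s, HasDerivWithinAt (X i k) (Literature.Analysis.FluidPDE.TaoCascade.quadTerm ε₀ α X i k t - ν * (1 + ε₀) ^ ((2 : ℝ) * k) * X i k t) (Set.Icc (0 : ℝ) s) t) → (∀ t ∈ Set.Icc (0 : ℝ) s, ∀ (i : Fin 4) (k : ℤ), 1 ≤ k → 0 ≤ X i k t) → ∀ t ∈ Set.Icc (0 : ℝ) s, ∀ (i : Fin 4) (k : ℕ), (1 + ε₀) ^ (2 * θ * (k : ℝ)) * ((1 / 2 : ℝ) * X i (k : ℤ) t ^ 2) ≤ D * (∑ j : Fin 4, (1 / 2 : ℝ) * X₀ j ^ 2)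

/-- SCALED ONE-MODE DYADIC TABLES: `α = c · dyadicTable` for some `c > 0` (the Katz–Pavlović
chain embedded on component `0`, `Literature.Analysis.FluidPDE.TaoCascade.dyadicTable`).
[this file; route SubOnsagerCeiling] -/
def IsScaledDyadic (α : Fin 4 → Fin 4 → Fin 4 → ℤ × ℤ × ℤ → ℝ) : Prop :=
  ∃ c : ℝ, 0 < c ∧ ∀ (i₁ i₂ i₃ : Fin 4) (μ : ℤ × ℤ × ℤ),
    α i₁ i₂ i₃ μ = c * Literature.Analysis.FluidPDE.TaoCascade.dyadicTable i₁ i₂ i₃ μ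

/-- Registered stub statement (RUNG, strictly below the crux): the shell barrier at scale ratio
`1 + ε₀ = 2` for every scaled one-mode dyadic table (Barbato–Morandin–Romito 2011 at `β = 5/2`,
`λ = 2`). [this file; route SubOnsagerCeiling] -/
def Sig.stub_dyadicRatioTwo : Prop :=
  ∀ R : ℝ, 1 ≤ R → ∀ α : Fin 4 → Fin 4 → Fin 4 → ℤ × ℤ × ℤ → ℝ, IsScaledDyadic α → ShellBarrierAt R 1 α

/-- Registered stub statement (STUB A, open): the shell barrier for EVERY table of `E₂(R)` in the
large-ratio regime `1/4 < ε₀ ≤ 1` (the orthant hypothesis is inside `ShellBarrierAt`).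
[this file; route SubOnsagerCeiling] -/
def Sig.stub_barrierLargeRatio : Prop :=
  ∀ R : ℝ, 1 ≤ R → ∀ ε₀ : ℝ, 1 / 4 < ε₀ → ε₀ ≤ 1 →
    ∀ α : Fin 4 → Fin 4 → Fin 4 → ℤ × ℤ × ℤ → ℝ, ShellBarrierAt R ε₀ α

/-- Registered stub statement (STUB B, open, hardest): the shell barrier for EVERY table of
`E₂(R)` in the small-ratio regime `0 < ε₀ ≤ 1/4`. [this file; route SubOnsagerCeiling] -/
def Sig.stub_barrierSmallRatio : Prop :=
  ∀ R : ℝ, 1 ≤ R → ∀ ε₀ : ℝ, 0 < ε₀ → ε₀ ≤ 1 / 4 →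
    ∀ α : Fin 4 → Fin 4 → Fin 4 → ℤ × ℤ × ℤ → ℝ, ShellBarrierAt R ε₀ α

/-- THE SIDE-BRANCH DEAD-END TABLE `α_SB` (lead prover-ns-soc-p2, numerical witness against the crux AS TYPED,
`Cruxes/OrthantTailCeiling/REFUTATION-EVIDENCE.md`): three Katz–Pavlović pairs on components `0` (chain), `1` (side),
`2` (pocket) — the chain feed `x²_{0,k} → x_{0,k+1}` with coefficient `1` (this part IS `dyadicTable`), the in-shell
side pump `x²_{0,k} → x_{1,k}` with coefficient `1/5`, and the feed `x²_{1,k} → x_{2,k+1}` with coefficient `1/5`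
into a component that feeds NOTHING (a dead end). Entries: `α_{aac,(0,0,1)} = w`, `α_{caa,(1,0,0)} = α_{aca,(0,1,0)} = −w/2`
for a feed `a → c` one shell up, `α_{aac,(0,0,0)} = w`, `α_{aca,(0,0,0)} = α_{caa,(0,0,0)} = −w/2` in-shell. It is symmetric,
cancelling, `10`-comparable and orthant (sibling file `SubOnsagerCeilingSideBranchWitness.lean`); along its honest viscous
solutions the pockets park tail energy `≍ E₀(1+ε₀)^{−5n/9}` (numerics + scaling law), which no `θ > 1/2` ceiling allows.
[this file; route SubOnsagerCeiling] -/
def sideBranchTable : Fin 4 → Fin 4 → Fin 4 → ℤ × ℤ × ℤ → ℝ := fun i₁ i₂ i₃ μ =>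
  Literature.Analysis.FluidPDE.TaoCascade.dyadicTable i₁ i₂ i₃ μ +
    (if i₁ = 0 ∧ i₂ = 0 ∧ i₃ = 1 ∧ μ = ((0 : ℤ), (0 : ℤ), (0 : ℤ)) then 1 / 5
      else if ((i₁ = 0 ∧ i₂ = 1) ∨ (i₁ = 1 ∧ i₂ = 0)) ∧ i₃ = 0 ∧ μ = ((0 : ℤ), (0 : ℤ), (0 : ℤ)) then -(1 / 10)
      else 0) +
    (if i₁ = 1 ∧ i₂ = 1 ∧ i₃ = 2 ∧ μ = ((0 : ℤ), (0 : ℤ), (1 : ℤ)) then 1 / 5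
      else if i₁ = 2 ∧ i₂ = 1 ∧ i₃ = 1 ∧ μ = ((1 : ℤ), (0 : ℤ), (0 : ℤ)) then -(1 / 10)
      else if i₁ = 1 ∧ i₂ = 2 ∧ i₃ = 1 ∧ μ = ((0 : ℤ), (1 : ℤ), (0 : ℤ)) then -(1 / 10)
      else 0)

end Summit.NavierStokesRegularity.NavierStokesRegularity.Theorems.SubOnsagerCeiling

end
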